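import Summits.CriticalPhenomena.PercolationContinuityZ3.Theorems.PercNearOneGluingNoHeavyLowerTailKnQuestion8PocketCertificate
import Summits.CriticalPhenomena.PercolationContinuityZ3.Theorems.PercNearOneGluingNoHeavyLowerTailKnQuestion8PocketPieces
import Summits.CriticalPhenomena.PercolationContinuityZ3.Theorems.PercNearOneGluingNoHeavyLowerTailKnQuestion8PocketAttach
import HarnessLib

/-!
# Kozma–Nitzan's Question 8 / MC-D for three relays — ASSEMBLY: (41) at the pocket-designated relay from the two named open
# inequalities PCOV (x-side, y-side) and (Z*D), every pocket family

Support file (`--supports stmt-CriticalPhenomena-4575`, closed), prover `prim-lf-2` (gen 16).  No definitions, no named facts, no sorries;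
standard axioms.  Memo `prim-lf-2/POCKET-CERT-gen16.md`.  This file wires the tree pieces
`PocketCert.attach_of_pocket` ((BHK-D), proved) → `PocketCert.p1star_pocket_of_pieces` ((P1*D) = t·PCOV + (1−t)·(BHK-D)) →
`PocketCert.opart_of_pocketHalves` ((O*D)) → `PocketCert.block41_three_of_pocketCert` ((41)) into ONE statement whose only substantive
hypotheses are the three census-clean, still unproved inequalities at `F = 1{b ∈ ·}`:
  PCOV_x : `b·(mDE1·IDFx − mDFx·IDE1) ≤ mDE2·((mDE1+mDFx)·(IxoE1+IxoF) − (a+d)·(IDE1+IDFx))`   (pocket covariance comparison, owner `x`),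
  PCOV_y : the same with `x ↔ y`,
  (Z*D)  : `μ(J' ∩ {z↔b}) ≤ λ·μ(P ∩ {x↮z} ∩ {z↔b}) + μ·μ(P ∩ {y↮z} ∩ {z↔b})`,
for a pocket family `𝒟` (down-closed vertex sets avoiding `x, y, z`; `P = {C_o ∈ 𝒟}`; Question 8: all such sets, Question 9: `{W ⊆ {o}}`), the
certificate point `t ∈ [0,1]`, `λ`, `μ` given by `t·(a·mDE2 + b·mDE1) = a·mDE2`, `λ·μ(P∩{x↮z}) = a + t d`, `μ·μ(P∩{y↮z}) = b + (1−t) d'`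
(masses `a = μ(W1)`, `b = μ(W2)`, `d = μ(x↔o,x↔y,x↮z)`, `d' = μ(y↔o,y↔x,y↮z)`, `mDE1 = μ(P, x↮y, x↮z)`, …), and the pocket designation
`μ(P ∩ {z↔b}) ≤ μ(P ∩ {x↔b}), μ(P ∩ {y↔b})`:
* `PocketCert.block41_three_of_pcov` — then `μ({z↔b} ∩ {o↔A}) ≤ μ({o↔b} ∩ {o↔A})`, `A = {x,y,z}`.
So Kozma–Nitzan's Question 8 at `|A| = 3` (and prim-lf-2's MC-D@3 for every pocket family) is reduced in the tree to PCOV and (Z*D)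
(prim-lf-2 gen-16 census: 0 violations in ≈ 5·10⁴ exact instances, n ≤ 9; neither in the cone of the tree's covariance rows).
[cite: KozmaNitzan2024, Questions 8–9 (§5.5 p. 36), display (41), §5.1 (pp. 31–32)] [cite: VandenbergHaggstromKahn2005, Thm. 2.1 (p. 9)]
-/

namespace Summit.CriticalPhenomena.PercolationContinuityZ3.Theorems

open MeasureTheory Set Literature.Probability.LatticeModels Literature.Probability.Percolation
open scoped Classical
open KNPreFKG

noncomputable section

namespace PocketCert

variable {V : Type*} [Fintype V]

/-- **(41) for three relays from PCOV_x, PCOV_y and (Z*D)** (see the file header for the notation; every other ingredient is a tree theorem).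
[cite: KozmaNitzan2024, Questions 8–9 (§5.5 p. 36), display (41)] -/
theorem block41_three_of_pcov (w : Sym2 V → unitInterval) (o b x y z : V) (𝒟 : Set (Set V)) (h𝒟 : IsLowerSet 𝒟)
    (hx𝒟 : ∀ W ∈ 𝒟, x ∉ W) (hy𝒟 : ∀ W ∈ 𝒟, y ∉ W) (hz𝒟 : ∀ W ∈ 𝒟, z ∉ W) (t lam mu : ℝ) (ht0 : 0 ≤ t) (ht1 : t ≤ 1)
    -- non-degeneracy of the pocket cells
    (hE1 : 0 < (prodBernoulli w).real ({ω : BondConfig V | openCluster ω o ∈ 𝒟} ∩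
      ({ω | ¬ (openGraph ω).Reachable x y} ∩ {ω | ¬ (openGraph ω).Reachable x z})))
    (hE2 : 0 < (prodBernoulli w).real ({ω : BondConfig V | openCluster ω o ∈ 𝒟} ∩
      ({ω | ¬ (openGraph ω).Reachable y x} ∩ {ω | ¬ (openGraph ω).Reachable y z})))
    -- the certificate point
    (ht : t * ((prodBernoulli w).real (openConn x o ∩ {ω | ¬ (openGraph ω).Reachable x y} ∩ {ω | ¬ (openGraph ω).Reachable x z}) *
          (prodBernoulli w).real ({ω : BondConfig V | openCluster ω o ∈ 𝒟} ∩
            ({ω | ¬ (openGraph ω).Reachable y x} ∩ {ω | ¬ (openGraph ω).Reachable y z})) +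
        (prodBernoulli w).real (openConn y o ∩ {ω | ¬ (openGraph ω).Reachable y x} ∩ {ω | ¬ (openGraph ω).Reachable y z}) *
          (prodBernoulli w).real ({ω : BondConfig V | openCluster ω o ∈ 𝒟} ∩
            ({ω | ¬ (openGraph ω).Reachable x y} ∩ {ω | ¬ (openGraph ω).Reachable x z}))) =
      (prodBernoulli w).real (openConn x o ∩ {ω | ¬ (openGraph ω).Reachable x y} ∩ {ω | ¬ (openGraph ω).Reachable x z}) *
        (prodBernoulli w).real ({ω : BondConfig V | openCluster ω o ∈ 𝒟} ∩
          ({ω | ¬ (openGraph ω).Reachable y x} ∩ {ω | ¬ (openGraph ω).Reachable y z})))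
    (hlam : lam * (prodBernoulli w).real ({ω : BondConfig V | openCluster ω o ∈ 𝒟} ∩ {ω | ¬ (openGraph ω).Reachable x z}) =
      (prodBernoulli w).real (openConn x o ∩ {ω | ¬ (openGraph ω).Reachable x y} ∩ {ω | ¬ (openGraph ω).Reachable x z}) +
        t * (prodBernoulli w).real (openConn x o ∩ openConn x y ∩ {ω | ¬ (openGraph ω).Reachable x z}))
    (hmu : mu * (prodBernoulli w).real ({ω : BondConfig V | openCluster ω o ∈ 𝒟} ∩ {ω | ¬ (openGraph ω).Reachable y z}) =
      (prodBernoulli w).real (openConn y o ∩ {ω | ¬ (openGraph ω).Reachable y x} ∩ {ω | ¬ (openGraph ω).Reachable y z}) +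
        (1 - t) * (prodBernoulli w).real (openConn y o ∩ openConn y x ∩ {ω | ¬ (openGraph ω).Reachable y z}))
    -- PCOV, x-side, at F = 1{b ∈ ·}
    (hPx : (prodBernoulli w).real (openConn y o ∩ {ω | ¬ (openGraph ω).Reachable y x} ∩ {ω | ¬ (openGraph ω).Reachable y z}) *
        ((prodBernoulli w).real ({ω : BondConfig V | openCluster ω o ∈ 𝒟} ∩
              ({ω | ¬ (openGraph ω).Reachable x y} ∩ {ω | ¬ (openGraph ω).Reachable x z})) *
            (prodBernoulli w).real ({ω : BondConfig V | openCluster ω o ∈ 𝒟} ∩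
              (openConn x y ∩ {ω | ¬ (openGraph ω).Reachable x z}) ∩ openConn x b) -
          (prodBernoulli w).real ({ω : BondConfig V | openCluster ω o ∈ 𝒟} ∩
              (openConn x y ∩ {ω | ¬ (openGraph ω).Reachable x z})) *
            (prodBernoulli w).real ({ω : BondConfig V | openCluster ω o ∈ 𝒟} ∩
              ({ω | ¬ (openGraph ω).Reachable x y} ∩ {ω | ¬ (openGraph ω).Reachable x z}) ∩ openConn x b)) ≤
      (prodBernoulli w).real ({ω : BondConfig V | openCluster ω o ∈ 𝒟} ∩
          ({ω | ¬ (openGraph ω).Reachable y x} ∩ {ω | ¬ (openGraph ω).Reachable y z})) *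
        (((prodBernoulli w).real ({ω : BondConfig V | openCluster ω o ∈ 𝒟} ∩
                ({ω | ¬ (openGraph ω).Reachable x y} ∩ {ω | ¬ (openGraph ω).Reachable x z})) +
              (prodBernoulli w).real ({ω : BondConfig V | openCluster ω o ∈ 𝒟} ∩
                (openConn x y ∩ {ω | ¬ (openGraph ω).Reachable x z}))) *
            ((prodBernoulli w).real (openConn x o ∩ {ω | ¬ (openGraph ω).Reachable x y} ∩ {ω | ¬ (openGraph ω).Reachable x z} ∩
                openConn x b) +
              (prodBernoulli w).real (openConn x o ∩ openConn x y ∩ {ω | ¬ (openGraph ω).Reachable x z} ∩ openConn x b)) -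
          ((prodBernoulli w).real (openConn x o ∩ {ω | ¬ (openGraph ω).Reachable x y} ∩ {ω | ¬ (openGraph ω).Reachable x z}) +
              (prodBernoulli w).real (openConn x o ∩ openConn x y ∩ {ω | ¬ (openGraph ω).Reachable x z})) *
            ((prodBernoulli w).real ({ω : BondConfig V | openCluster ω o ∈ 𝒟} ∩
                ({ω | ¬ (openGraph ω).Reachable x y} ∩ {ω | ¬ (openGraph ω).Reachable x z}) ∩ openConn x b) +
              (prodBernoulli w).real ({ω : BondConfig V | openCluster ω o ∈ 𝒟} ∩
                (openConn x y ∩ {ω | ¬ (openGraph ω).Reachable x z}) ∩ openConn x b))))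
    -- PCOV, y-side, at F = 1{b ∈ ·}
    (hPy : (prodBernoulli w).real (openConn x o ∩ {ω | ¬ (openGraph ω).Reachable x y} ∩ {ω | ¬ (openGraph ω).Reachable x z}) *
        ((prodBernoulli w).real ({ω : BondConfig V | openCluster ω o ∈ 𝒟} ∩
              ({ω | ¬ (openGraph ω).Reachable y x} ∩ {ω | ¬ (openGraph ω).Reachable y z})) *
            (prodBernoulli w).real ({ω : BondConfig V | openCluster ω o ∈ 𝒟} ∩
              (openConn y x ∩ {ω | ¬ (openGraph ω).Reachable y z}) ∩ openConn y b) -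
          (prodBernoulli w).real ({ω : BondConfig V | openCluster ω o ∈ 𝒟} ∩
              (openConn y x ∩ {ω | ¬ (openGraph ω).Reachable y z})) *
            (prodBernoulli w).real ({ω : BondConfig V | openCluster ω o ∈ 𝒟} ∩
              ({ω | ¬ (openGraph ω).Reachable y x} ∩ {ω | ¬ (openGraph ω).Reachable y z}) ∩ openConn y b)) ≤
      (prodBernoulli w).real ({ω : BondConfig V | openCluster ω o ∈ 𝒟} ∩
          ({ω | ¬ (openGraph ω).Reachable x y} ∩ {ω | ¬ (openGraph ω).Reachable x z})) *
        (((prodBernoulli w).real ({ω : BondConfig V | openCluster ω o ∈ 𝒟} ∩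
                ({ω | ¬ (openGraph ω).Reachable y x} ∩ {ω | ¬ (openGraph ω).Reachable y z})) +
              (prodBernoulli w).real ({ω : BondConfig V | openCluster ω o ∈ 𝒟} ∩
                (openConn y x ∩ {ω | ¬ (openGraph ω).Reachable y z}))) *
            ((prodBernoulli w).real (openConn y o ∩ {ω | ¬ (openGraph ω).Reachable y x} ∩ {ω | ¬ (openGraph ω).Reachable y z} ∩
                openConn y b) +
              (prodBernoulli w).real (openConn y o ∩ openConn y x ∩ {ω | ¬ (openGraph ω).Reachable y z} ∩ openConn y b)) -
          ((prodBernoulli w).real (openConn y o ∩ {ω | ¬ (openGraph ω).Reachable y x} ∩ {ω | ¬ (openGraph ω).Reachable y z}) +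
              (prodBernoulli w).real (openConn y o ∩ openConn y x ∩ {ω | ¬ (openGraph ω).Reachable y z})) *
            ((prodBernoulli w).real ({ω : BondConfig V | openCluster ω o ∈ 𝒟} ∩
                ({ω | ¬ (openGraph ω).Reachable y x} ∩ {ω | ¬ (openGraph ω).Reachable y z}) ∩ openConn y b) +
              (prodBernoulli w).real ({ω : BondConfig V | openCluster ω o ∈ 𝒟} ∩
                (openConn y x ∩ {ω | ¬ (openGraph ω).Reachable y z}) ∩ openConn y b))))
    -- the weak-relay part (Z*D) at F = 1{b ∈ ·}
    (hZ : (prodBernoulli w).real ((openConn o x ∪ openConn o y) ∩ {ω | ¬ (openGraph ω).Reachable o z} ∩ openConn z b) ≤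
      lam * (prodBernoulli w).real ({ω : BondConfig V | openCluster ω o ∈ 𝒟} ∩ {ω | ¬ (openGraph ω).Reachable x z} ∩ openConn z b) +
        mu * (prodBernoulli w).real ({ω : BondConfig V | openCluster ω o ∈ 𝒟} ∩ {ω | ¬ (openGraph ω).Reachable y z} ∩ openConn z b))
    -- the pocket designation of `z`
    (hzx : (prodBernoulli w).real ({ω : BondConfig V | openCluster ω o ∈ 𝒟} ∩ openConn z b) ≤
      (prodBernoulli w).real ({ω : BondConfig V | openCluster ω o ∈ 𝒟} ∩ openConn x b))
    (hzy : (prodBernoulli w).real ({ω : BondConfig V | openCluster ω o ∈ 𝒟} ∩ openConn z b) ≤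
      (prodBernoulli w).real ({ω : BondConfig V | openCluster ω o ∈ 𝒟} ∩ openConn y b)) :
    (prodBernoulli w).real (openConn z b ∩ (openConn o x ∪ openConn o y ∪ openConn o z)) ≤
      (prodBernoulli w).real (openConn o b ∩ (openConn o x ∪ openConn o y ∪ openConn o z)) := by
  classical
  set μ := prodBernoulli w with hμ
  have hmeas : ∀ S : Set (BondConfig V), MeasurableSet S := fun _ => MeasurableSet.of_discrete
  have hn := fun (S : Set (BondConfig V)) => (measureReal_nonneg : 0 ≤ μ.real S)
  -- names
  set P : Set (BondConfig V) := {ω : BondConfig V | openCluster ω o ∈ 𝒟} with hP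
  set E1x : Set (BondConfig V) := {ω : BondConfig V | ¬ (openGraph ω).Reachable x y} ∩ {ω | ¬ (openGraph ω).Reachable x z} with hE1x
  set Fx : Set (BondConfig V) := openConn x y ∩ {ω : BondConfig V | ¬ (openGraph ω).Reachable x z} with hFx
  set E2y : Set (BondConfig V) := {ω : BondConfig V | ¬ (openGraph ω).Reachable y x} ∩ {ω | ¬ (openGraph ω).Reachable y z} with hE2y
  set Fy : Set (BondConfig V) := openConn y x ∩ {ω : BondConfig V | ¬ (openGraph ω).Reachable y z} with hFy
  set W1 : Set (BondConfig V) := openConn x o ∩ {ω | ¬ (openGraph ω).Reachable x y} ∩ {ω | ¬ (openGraph ω).Reachable x z} with hW1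
  set W2 : Set (BondConfig V) := openConn y o ∩ {ω | ¬ (openGraph ω).Reachable y x} ∩ {ω | ¬ (openGraph ω).Reachable y z} with hW2
  set W3x : Set (BondConfig V) := openConn x o ∩ openConn x y ∩ {ω | ¬ (openGraph ω).Reachable x z} with hW3x
  set W3y : Set (BondConfig V) := openConn y o ∩ openConn y x ∩ {ω | ¬ (openGraph ω).Reachable y z} with hW3y
  set F : Set V → ℝ := fun T => T.indicator (1 : V → ℝ) b with hF
  have hFmono : ∀ S T : Set V, S ⊆ T → F S ≤ F T := by
    intro S T hST
    simp only [hF]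
    by_cases hb : b ∈ S
    · rw [indicator_of_mem hb, indicator_of_mem (hST hb)]
    · rw [indicator_of_notMem hb]
      by_cases hb' : b ∈ T
      · rw [indicator_of_mem hb']; simp
      · rw [indicator_of_notMem hb']
  have hI : ∀ (v : V) (S : Set (BondConfig V)), ∫ ω in S, F (openCluster ω v) ∂μ = μ.real (S ∩ openConn v b) :=
    fun v S => setIntegral_indicator_openCluster μ b v S
  -- (BHK-D) for both owners, at `F = 1{b ∈ ·}`
  have hBx : μ.real W1 * μ.real (P ∩ E1x ∩ openConn x b) ≤ μ.real (P ∩ E1x) * μ.real (W1 ∩ openConn x b) := by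
    have h := attach_of_pocket w o x y z 𝒟 h𝒟 hy𝒟 hz𝒟 F hFmono
    rw [hI, hI] at h
    exact h
  have hBy : μ.real W2 * μ.real (P ∩ E2y ∩ openConn y b) ≤ μ.real (P ∩ E2y) * μ.real (W2 ∩ openConn y b) := by
    have h := attach_of_pocket w o y x z 𝒟 h𝒟 hx𝒟 hz𝒟 F hFmono
    rw [hI, hI] at h
    exact h
  -- the reference cells partition `P ∩ {x ↮ z}` resp. `P ∩ {y ↮ z}`
  have splitx : ∀ X : Set (BondConfig V), μ.real (P ∩ {ω | ¬ (openGraph ω).Reachable x z} ∩ X) =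
      μ.real (P ∩ E1x ∩ X) + μ.real (P ∩ Fx ∩ X) := by
    intro X
    have hdj : Disjoint (P ∩ E1x ∩ X) (P ∩ Fx ∩ X) := by
      rw [Set.disjoint_left]
      rintro ω ⟨⟨-, hxy, -⟩, -⟩ ⟨⟨-, hxy', -⟩, -⟩
      exact hxy hxy'
    rw [← measureReal_union hdj (hmeas _)]
    congr 1
    ext ω
    simp only [hE1x, hFx, mem_inter_iff, mem_union, mem_setOf_eq, openConn]
    tauto
  have splity : ∀ X : Set (BondConfig V), μ.real (P ∩ {ω | ¬ (openGraph ω).Reachable y z} ∩ X) =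
      μ.real (P ∩ E2y ∩ X) + μ.real (P ∩ Fy ∩ X) := by
    intro X
    have hdj : Disjoint (P ∩ E2y ∩ X) (P ∩ Fy ∩ X) := by
      rw [Set.disjoint_left]
      rintro ω ⟨⟨-, hyx, -⟩, -⟩ ⟨⟨-, hyx', -⟩, -⟩
      exact hyx hyx'
    rw [← measureReal_union hdj (hmeas _)]
    congr 1
    ext ω
    simp only [hE2y, hFy, mem_inter_iff, mem_union, mem_setOf_eq, openConn]
    tauto
  have massx : μ.real (P ∩ {ω | ¬ (openGraph ω).Reachable x z}) = μ.real (P ∩ E1x) + μ.real (P ∩ Fx) := by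
    have h := splitx univ
    simp only [inter_univ] at h
    exact h
  have massy : μ.real (P ∩ {ω | ¬ (openGraph ω).Reachable y z}) = μ.real (P ∩ E2y) + μ.real (P ∩ Fy) := by
    have h := splity univ
    simp only [inter_univ] at h
    exact h
  -- (P1*D) for both owners
  rw [massx] at hlam
  rw [massy] at hmu
  have ht' : (1 - t) * (μ.real W2 * μ.real (P ∩ E1x) + μ.real W1 * μ.real (P ∩ E2y)) = μ.real W2 * μ.real (P ∩ E1x) := by
    linear_combination (-1 : ℝ) * ht
  have hP1x := p1star_pocket_of_pieces (μ.real (W1 ∩ openConn x b)) (μ.real (W3x ∩ openConn x b))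
    (μ.real (P ∩ E1x ∩ openConn x b)) (μ.real (P ∩ Fx ∩ openConn x b)) (μ.real W1) (μ.real W3x) (μ.real W2)
    (μ.real (P ∩ E1x)) (μ.real (P ∩ Fx)) (μ.real (P ∩ E2y)) t lam ht0 ht1 hE1 hE2 (hn _) ht hlam hBx hPx
  have hP1y := p1star_pocket_of_pieces (μ.real (W2 ∩ openConn y b)) (μ.real (W3y ∩ openConn y b))
    (μ.real (P ∩ E2y ∩ openConn y b)) (μ.real (P ∩ Fy ∩ openConn y b)) (μ.real W2) (μ.real W3y) (μ.real W1)
    (μ.real (P ∩ E2y)) (μ.real (P ∩ Fy)) (μ.real (P ∩ E1x)) (1 - t) mu (by linarith) (by linarith) hE2 hE1 (hn _) ht' hmu hBy hPy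
  -- (O*D) from the two halves
  have hO' := opart_of_pocketHalves w o x y z F t (lam * μ.real (P ∩ {ω | ¬ (openGraph ω).Reachable x z} ∩ openConn x b))
    (mu * μ.real (P ∩ {ω | ¬ (openGraph ω).Reachable y z} ∩ openConn y b))
    (by rw [hI, hI, splitx]; exact hP1x) (by rw [hI, hI, splity]; exact hP1y)
  rw [hI] at hO'
  -- multipliers are nonnegative
  have hlam0 : 0 ≤ lam := by
    have hpos : 0 < μ.real (P ∩ E1x) + μ.real (P ∩ Fx) := by linarith [hn (P ∩ Fx)]
    have : 0 ≤ lam * (μ.real (P ∩ E1x) + μ.real (P ∩ Fx)) := by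
      rw [hlam]; exact add_nonneg (hn _) (mul_nonneg ht0 (hn _))
    exact (mul_nonneg_iff_of_pos_right hpos).1 this
  have hmu0 : 0 ≤ mu := by
    have hpos : 0 < μ.real (P ∩ E2y) + μ.real (P ∩ Fy) := by linarith [hn (P ∩ Fy)]
    have : 0 ≤ mu * (μ.real (P ∩ E2y) + μ.real (P ∩ Fy)) := by
      rw [hmu]; exact add_nonneg (hn _) (mul_nonneg (by linarith) (hn _))
    exact (mul_nonneg_iff_of_pos_right hpos).1 this
  exact block41_three_of_pocketCert w o b x y z P lam mu hlam0 hmu0 hO' hZ hzx hzy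

end PocketCert

end

end Summit.CriticalPhenomena.PercolationContinuityZ3.Theorems
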